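/-
Copyright: statement-level skeleton of a published paper (lit-balaban cell, Phase-2 proof seat p13, gen 3). No proof
claims beyond what the kernel checks below.
-/
import Literature.MathematicalPhysics.QuantumFieldTheory.Balaban1983to89.B4Sect5WalkPerturb

/-!
# `Balaban1983to89.B4Sect5WalkDelta` — T. Bałaban, *Regularity and decay of lattice Green's functions*, Commun.
Math. Phys. **89** (1983) 571–597 [Balaban1983RegularityDecay] (= B4), Sect. 5, p. 596 [PDF 26]:
**(5.22)–(5.23) ⇒ (5.8) ALONG THE GENERALIZED RANDOM WALK** — with `B4Sect5WalkDecay` ((5.7)) and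
`B4Sect5WalkPerturb` ((5.10)) this completes the printed proof of the Sect. 5 Theorem (5.6)–(5.10)

statement-level skeleton of published theorems with citation tags; proofs where landed; nothing here is a claim
about the Yang–Mills mass gap

PDF held: `paper:balaban1983-cmp89-regularity-decay` (journal page = PDF page + 570); page render
`run/shared/lean/pub/pub-balaban/b2b-balaban-ref1/pages/1983-cmp89-regularity-decay/…-p026-x2.png`; verbatim text
from the cell transcript `run/shared/lean/pub/pub-balaban/b2b-balaban-b04/transcript-B4.md` ll. 336–380.

CITATION HEADER (lean-in-tree rule).  Part of the lit-balaban TYPED SKELETON (HOME `run/shared/lean/pub/lit-balaban/`):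
WHAT IS REPRODUCED = row **B4.Eq5.15** of `HOME/lit-balaban-r01/ROWS-B4.md`, members **(5.22), (5.23)** and the
conclusion **(5.8)** they prove; with the sibling files the row's *"conclusions = Sect. 5 Theorem"* are
re-proved along the PRINTED route (`concl57_58_compress_walk` here + `B4Sect5WalkPerturb.concl510_compress_walk` =
the two conjuncts of `B4.Sect5ThmUniform`, which is NOT re-declared: it is already the theorem
`B4Sect5Proof.sect5ThmUniform_holds`, by finite Combes–Thomas and block algebra).  Unit `lit-balaban-p13` (gen 3);
owner r01; referee ref-4.  Fifth
file of the seat's Sect.-5 chain (`B4Sect5RandomWalk` p244548, `B4Sect5CubeBounds` p245229/p245700,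
`B4Sect5WalkDecay` p247099, `B4Sect5WalkPerturb` p247894 — all IMPORTED; nothing landed is edited).

THE PRINTED TEXT (verbatim, p. 594 and p. 596 [PDF 24, 26]).  *"|δC_Λ(x,x′)| ≤ c₁e^{−δ₁(|x−x′| + dist(x,Λ^c) +
dist(x′,Λ^c))}, δC_Λ = C_Λ − C_Ω. (5.8)"* […] *"The inequality (5.8) is proved using the representations (5.17) for
both operators C_Λ, C_Ω and properly taking into account cancellations of some terms, exactly as in the proof of
bounds for δG_k(Ω,Ω₀,A) in Sect. 2.  We define □′_j by the equality (5.11) with Ω instead of Λ, and C′_j = C_{□′_j}.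
If □′_j is disjoint with the complement Λ^c of Λ in Ω, then □′_j = □_j and C′_j = C_j. Similarly if both □′_j, □′_{j′}
are disjoint with Λ^c, then R′_{j,j′} = R_{j,j′}. Let us take a difference of the representations (5.17) for C_Λ and
C_Ω. In this difference all terms corresponding to walks ω with □′_{ω_i} disjoint with Λ^c are canceled, and we have
δC_Λ(x,x′) = Σ_{ω: x∈□_{ω₀}, x′∈□_{ω_{2n}}, for some i □′_{ω_i}∩Λ^c ≠ ∅}⟨δ_x, h_{ω₀}C_{ω₀}h_{ω₀}R_{ω₁,ω₂}C_{ω₂}h_{ω₂}·…·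
R_{ω_{2n−1},ω_{2n}}C_{ω_{2n}}h_{ω_{2n}}δ_{x′}⟩ − Σ_{ω′: …, for some i □′_{ω′_i}∩Λ^c ≠ ∅}⟨δ_x, h_{ω′₀}C′_{ω′₀}h_{ω′₀}R′_{ω′₁,ω′₂}
C′_{ω′₂}h_{ω′₂}·…·R′_{ω′_{2n−1},ω′_{2n}}C′_{2n}h_{ω′_{2n}}δ_{x′}⟩. (5.22)  The range of ω′_i in the second sum might be
larger because Ω ⊃ Λ. Estimating (5.22) in the same way as in (5.18) and (5.21), we get
|δC_Λ(x,x′)| ≤ c′₁e^{−⅓δ₂M^{−1}(dist(x,Λ^c) + dist(x′,Λ^c) + |x−x′|)}. (5.23)"*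

THE TYPING (what is proved, and not more).
* SETTING = that of `B4`: finite `Λ ⊆ Ω ⊂ ℤ^d`, `A` on `L²(Ω; ℝ^N)` with (5.6) (`B4.Hyp56 Ω A γ₀ c₀ δ₀`), `C_Ω = A^{−1}`,
  `C_Λ = A_Λ^{−1}` (`B4.compress`), `Λ^c = Ω ∖ Λ` (*"the complement Λ^c of Λ in Ω"*), `dist(x,Λ^c) = Metric.infDist x
  (Ω ∖ Λ)` — the second clause of `B4.Concl57_58 Ω Λ h A c₁ δ₁`.
* THE TWO REPRESENTATIONS ON ONE CUBE SYSTEM (DIVERGENCE in bookkeeping, not in the statement).  The print expands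
  `C_Λ` on the `Λ`-cubes `□_j` and `C_Ω` on the `Ω`-cubes `□′_j` and identifies the factors of the two expansions for
  the cubes avoiding `Λ^c`.  Here the `Λ`-side expansion is organised on the `Ω`-cubes as well, through the DECOUPLED
  operator `A_dec = ΛAΛ + Λ^cAΛ^c = A + B_dec` on `L²(Ω)` (`B_dec(x,x′) = −A(x,x′)` if exactly one of `x, x′` lies in
  `Λ`, else `0`): `A_dec` satisfies (5.6) with `A` (`hyp56_add_decouple`), and ITS INVERSE RESTRICTED TO `Λ` IS `C_Λ`
  (`inv_compress_apply_eq`: `A_dec^{−1}(x,x′) = C_Λ(x,x′)` for `x, x′ ∈ Λ`, by `B4Sect5Proof.deltaC_eq` with vanishing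
  off-block).  So `δC_Λ(x,x′) = A_dec^{−1}(x,x′) − A^{−1}(x,x′)` is EXACTLY the difference (5.24) of the two (5.17)
  expansions of `B4Sect5WalkPerturb` (for `A` and `A + B_dec`, same cubes `□′_j`), and the print's cancellation
  *"If □′_j is disjoint with Λ^c then C′_j = C_j … R′_{j,j′} = R_{j,j′} … all terms corresponding to walks ω with
  □′_{ω_i} disjoint with Λ^c are canceled"* is the VANISHING OF THE (5.24)-DEFECTS for such cubes:
  `cOp_add_decouple_eq` (`C(A_dec)_j = C(A)_j` when `□′_j ∩ Λ^c = ∅`) and `rPair_add_decouple_eq`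
  (`R(A_dec)_{j,j′} = R(A)_{j,j′}` when `□′_j, □′_{j′}` avoid `Λ^c`).
* (5.23) *"Estimating (5.22) in the same way as in (5.18) and (5.21)"*: `B_dec` obeys the (5.9)-type bound
  `|B_dec(x,x′)| ≤ c₀e^{−(δ₀/2)(|x−x′| + dist(x,Λ^c) + dist(x′,Λ^c))}` (`decouple_bound`: a non-zero entry has one end
  IN `Λ^c`), so the summation of `B4Sect5WalkPerturb` ((5.18)/(5.21)-style weighted Schur line, boundary exchange
  along the walk) applies with `D = dist(·,Λ^c)` and `δ₀/2` in place of `δ₀` ((5.6) is monotone in `δ₀`,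
  `hyp56_of_delta_le`): **`concl58_compress_walk`** — constants `c₁, δ₁ > 0` depending on `d, N, γ₀, c₀, δ₀` only with
  `|C_Λ(x,x′) − C_Ω(x,x′)| ≤ c₁e^{−δ₁(|x−x′| + dist(x,Λ^c) + dist(x′,Λ^c))}` for every finite `Ω`, every `A` with (5.6)
  and every `Λ ⊆ Ω` (the print's rate `⅓δ₂M^{−1}` becomes `δ₀/(96M)`; constants not optimized).
* **`concl57_58_compress_walk`**: (5.7) (`B4Sect5WalkDecay.concl57_compress_walk`) and (5.8) (this file) with
  common constants (`B4Sect5Proof.weaken`) = `B4.Concl57_58 Ω Λ h A c₁ δ₁` for every finite `Ω`, `A` with (5.6),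
  `Λ ⊆ Ω` — the first conjunct of `B4.Sect5ThmUniform`; the second is `B4Sect5WalkPerturb.concl510_compress_walk`.
  (`B4.Sect5ThmUniform d N` itself is already the theorem `B4Sect5Proof.sect5ThmUniform_holds` and is not
  re-declared; these files certify the PRINTED route to its conjuncts, for `c₀ ≥ 0`.)
* NOT HERE: (5.19) (Fourier formula).  No `def` is introduced (`B_dec`, `A_dec` are abbreviations of this docstring;
  the statements spell the matrix out).
-/

namespace Literature.MathematicalPhysics.QuantumFieldTheory.Balaban1983to89.B4Sect5WalkDelta

open scoped BigOperators
open Finset Matrix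

section Decouple

open Literature.MathematicalPhysics.QuantumFieldTheory.Balaban1983to89
open B4Commutators25to211 B4Sect5RandomWalk B4Sect5Proof B6GOmega B4Sect5CubeBounds B4RandomWalk213
  B4Sect5WalkDecay B4Sect5WalkPerturb
open scoped Matrix.Norms.L2Operator

variable {d N : ℕ} {Ω : Finset (Fin d → ℤ)} {γ₀ c₀ δ₀ : ℝ}

/-- entries of the decoupled operator `A_dec = A + B_dec = ΛAΛ + Λ^cAΛ^c`: `A(x,x′)` if `x, x′` lie on the same side of
`Λ`, else `0` (the operator whose (5.17) expansion on the `Ω`-cubes is the print's expansion *"for C_Λ"*).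
[cite: Balaban1983RegularityDecay, (5.22) p.596] -/
theorem add_decouple_apply (Λ : Finset (Fin d → ℤ)) (A : Matrix (B4.Idx Ω N) (B4.Idx Ω N) ℝ)
    (p q : B4.Idx Ω N) :
    (A + Matrix.of fun p q : B4.Idx Ω N =>
        if ((p.1 : Fin d → ℤ) ∈ Λ ↔ (q.1 : Fin d → ℤ) ∈ Λ) then (0:ℝ) else -A p q) p q =
      if ((p.1 : Fin d → ℤ) ∈ Λ ↔ (q.1 : Fin d → ℤ) ∈ Λ) then A p q else 0 := by
  rw [Matrix.add_apply, Matrix.of_apply]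
  split_ifs <;> ring

/-- **`A_dec` satisfies (5.6) with the constants of `A`** (symmetric; `⟨φ, A_decφ⟩ = ⟨Λφ, AΛφ⟩ + ⟨Λ^cφ, AΛ^cφ⟩ ≥
γ₀‖φ‖²`; `|A_dec(x,x′)| ≤ |A(x,x′)|`) — so the expansion (5.17) and the estimates (5.18)–(5.21) apply to it exactly as
to `A` (*"Estimating (5.22) in the same way as in (5.18) and (5.21)"*). [cite: Balaban1983RegularityDecay, (5.6)
p.594; (5.22)–(5.23) p.596] -/
theorem hyp56_add_decouple (Λ : Finset (Fin d → ℤ)) (hc : 0 ≤ c₀) {A : Matrix (B4.Idx Ω N) (B4.Idx Ω N) ℝ}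
    (hA : B4.Hyp56 Ω A γ₀ c₀ δ₀) :
    B4.Hyp56 Ω (A + Matrix.of fun p q : B4.Idx Ω N =>
      if ((p.1 : Fin d → ℤ) ∈ Λ ↔ (q.1 : Fin d → ℤ) ∈ Λ) then (0:ℝ) else -A p q) γ₀ c₀ δ₀ := by
  obtain ⟨hs, hl, hd⟩ := hA
  set B : Matrix (B4.Idx Ω N) (B4.Idx Ω N) ℝ := Matrix.of fun p q : B4.Idx Ω N =>
    if ((p.1 : Fin d → ℤ) ∈ Λ ↔ (q.1 : Fin d → ℤ) ∈ Λ) then (0:ℝ) else -A p q with hB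
  have happ : ∀ p q, (A + B) p q = if ((p.1 : Fin d → ℤ) ∈ Λ ↔ (q.1 : Fin d → ℤ) ∈ Λ) then A p q else 0 :=
    fun p q => add_decouple_apply Λ A p q
  refine ⟨?_, ?_, ?_⟩
  · refine Matrix.IsSymm.ext fun p q => ?_
    rw [happ, happ, hs.apply p q]
    by_cases hp : (p.1 : Fin d → ℤ) ∈ Λ <;> by_cases hq : (q.1 : Fin d → ℤ) ∈ Λ <;> simp [hp, hq]
  · intro v
    set vΛ : B4.Idx Ω N → ℝ := fun q => if (q.1 : Fin d → ℤ) ∈ Λ then v q else 0 with hvΛ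
    set vc : B4.Idx Ω N → ℝ := fun q => if (q.1 : Fin d → ℤ) ∈ Λ then 0 else v q with hvc
    have h1 := hl vΛ
    have h2 := hl vc
    have hsplit : ∀ p, v p * (A + B).mulVec v p = vΛ p * A.mulVec vΛ p + vc p * A.mulVec vc p := by
      intro p
      have e1 : (A + B).mulVec v p =
          if (p.1 : Fin d → ℤ) ∈ Λ then A.mulVec vΛ p else A.mulVec vc p := by
        simp only [Matrix.mulVec, dotProduct]
        split_ifs with hp
        · refine Finset.sum_congr rfl fun q _ => ?_
          rw [happ, hvΛ]
          simp only [hp, true_iff]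
          split_ifs <;> ring
        · refine Finset.sum_congr rfl fun q _ => ?_
          rw [happ, hvc]
          simp only [hp, false_iff]
          split_ifs <;> ring
      rw [e1]
      by_cases hp : (p.1 : Fin d → ℤ) ∈ Λ <;> simp [hvΛ, hvc, hp]
    have hsq : ∀ p, v p ^ 2 = vΛ p ^ 2 + vc p ^ 2 := by
      intro p; by_cases hp : (p.1 : Fin d → ℤ) ∈ Λ <;> simp [hvΛ, hvc, hp]
    calc γ₀ * ∑ p, v p ^ 2 = γ₀ * ∑ p, vΛ p ^ 2 + γ₀ * ∑ p, vc p ^ 2 := by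
          rw [← mul_add, ← Finset.sum_add_distrib]
          congr 1
          exact Finset.sum_congr rfl fun p _ => hsq p
      _ ≤ ∑ p, vΛ p * A.mulVec vΛ p + ∑ p, vc p * A.mulVec vc p := add_le_add h1 h2
      _ = ∑ p, v p * (A + B).mulVec v p := by
          rw [← Finset.sum_add_distrib]
          exact Finset.sum_congr rfl fun p _ => (hsplit p).symm
  · intro p q
    rw [happ]
    split_ifs
    · exact hd p q
    · rw [abs_zero]; positivity

/-- (5.6) is monotone in the decay rate: `δ₀′ ≤ δ₀` keeps (5.6) (used with `δ₀′ = ½δ₀` for the (5.9)-type bound of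
`B_dec`). [cite: Balaban1983RegularityDecay, (5.6) p.594] -/
theorem hyp56_of_delta_le {δ₀' : ℝ} (hc : 0 ≤ c₀) (hδ' : δ₀' ≤ δ₀) {A : Matrix (B4.Idx Ω N) (B4.Idx Ω N) ℝ}
    (hA : B4.Hyp56 Ω A γ₀ c₀ δ₀) : B4.Hyp56 Ω A γ₀ c₀ δ₀' := by
  refine ⟨hA.1, hA.2.1, fun p q => (hA.2.2 p q).trans (mul_le_mul_of_nonneg_left (Real.exp_le_exp.mpr ?_) hc)⟩
  have h0 : 0 ≤ dist (p.1 : Fin d → ℤ) (q.1 : Fin d → ℤ) := dist_nonneg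
  nlinarith

/-- **THE (5.9)-TYPE BOUND OF THE DECOUPLING DEFECT**: `|B_dec(x,x′)| ≤ c₀e^{−½δ₀(|x−x′| + dist(x,Λ^c) + dist(x′,Λ^c))}`,
`Λ^c = Ω ∖ Λ` — a non-zero entry has exactly one of `x, x′` in `Λ^c`, where `dist(·,Λ^c) = 0`, and the other at distance
`≤ |x − x′|` from it (the surviving walks of (5.22) *"for some i □′_{ω_i} ∩ Λ^c ≠ ∅"* are those seeing such entries).
[cite: Balaban1983RegularityDecay, (5.22)–(5.23) p.596; (5.9) p.594] -/
theorem decouple_bound (Λ : Finset (Fin d → ℤ)) (hc : 0 ≤ c₀) (hδ : 0 ≤ δ₀)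
    {A : Matrix (B4.Idx Ω N) (B4.Idx Ω N) ℝ}
    (hd : ∀ p q : B4.Idx Ω N, |A p q| ≤ c₀ * Real.exp (-(δ₀ * dist (p.1 : Fin d → ℤ) (q.1 : Fin d → ℤ))))
    (p q : B4.Idx Ω N) :
    |(Matrix.of fun p q : B4.Idx Ω N =>
        if ((p.1 : Fin d → ℤ) ∈ Λ ↔ (q.1 : Fin d → ℤ) ∈ Λ) then (0:ℝ) else -A p q) p q| ≤
      c₀ * Real.exp (-(δ₀ / 2 * (dist (p.1 : Fin d → ℤ) (q.1 : Fin d → ℤ) +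
        Metric.infDist (p.1 : Fin d → ℤ) (((Ω \ Λ : Finset (Fin d → ℤ))) : Set (Fin d → ℤ)) +
        Metric.infDist (q.1 : Fin d → ℤ) (((Ω \ Λ : Finset (Fin d → ℤ))) : Set (Fin d → ℤ))))) := by
  rw [Matrix.of_apply]
  set S : Set (Fin d → ℤ) := (((Ω \ Λ : Finset (Fin d → ℤ))) : Set (Fin d → ℤ)) with hS
  have hD0p := Metric.infDist_nonneg (x := (p.1 : Fin d → ℤ)) (s := S)
  have hD0q := Metric.infDist_nonneg (x := (q.1 : Fin d → ℤ)) (s := S)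
  have hdist : 0 ≤ dist (p.1 : Fin d → ℤ) (q.1 : Fin d → ℤ) := dist_nonneg
  split_ifs with hpq
  · rw [abs_zero]; positivity
  · rw [abs_neg]
    refine (hd p q).trans (mul_le_mul_of_nonneg_left (Real.exp_le_exp.mpr ?_) hc)
    have key : Metric.infDist (p.1 : Fin d → ℤ) S + Metric.infDist (q.1 : Fin d → ℤ) S ≤
        dist (p.1 : Fin d → ℤ) (q.1 : Fin d → ℤ) := by
      by_cases hp : (p.1 : Fin d → ℤ) ∈ Λ
      · have hq : (q.1 : Fin d → ℤ) ∉ Λ := fun hq => hpq ⟨fun _ => hq, fun _ => hp⟩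
        have hqS : (q.1 : Fin d → ℤ) ∈ S := by
          rw [hS, Finset.mem_coe, Finset.mem_sdiff]; exact ⟨q.1.2, hq⟩
        rw [Metric.infDist_zero_of_mem hqS, add_zero]
        exact Metric.infDist_le_dist_of_mem hqS
      · have hq : (q.1 : Fin d → ℤ) ∈ Λ := by
          by_contra hq; exact hpq ⟨fun h => absurd h hp, fun h => absurd h hq⟩
        have hpS : (p.1 : Fin d → ℤ) ∈ S := by
          rw [hS, Finset.mem_coe, Finset.mem_sdiff]; exact ⟨p.1.2, hp⟩
        rw [Metric.infDist_zero_of_mem hpS, zero_add, dist_comm]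
        exact Metric.infDist_le_dist_of_mem hpS
    have h2 : δ₀ / 2 * (dist (p.1 : Fin d → ℤ) (q.1 : Fin d → ℤ) +
        Metric.infDist (p.1 : Fin d → ℤ) S + Metric.infDist (q.1 : Fin d → ℤ) S) ≤
        δ₀ / 2 * (2 * dist (p.1 : Fin d → ℤ) (q.1 : Fin d → ℤ)) :=
      mul_le_mul_of_nonneg_left (by linarith) (by positivity)
    linarith

/-- the off-block `ΛA_dec(Ω∖Λ)` of the decoupled operator VANISHES (it is block-diagonal w.r.t. `Λ ⊕ Λ^c`).
[cite: Balaban1983RegularityDecay, (5.22) p.596] -/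
theorem offBlock_add_decouple {Λ : Finset (Fin d → ℤ)} (h : Λ ⊆ Ω) (A : Matrix (B4.Idx Ω N) (B4.Idx Ω N) ℝ) :
    offBlock h (A + Matrix.of fun p q : B4.Idx Ω N =>
      if ((p.1 : Fin d → ℤ) ∈ Λ ↔ (q.1 : Fin d → ℤ) ∈ Λ) then (0:ℝ) else -A p q) = 0 := by
  ext r s
  rw [offBlock_apply, Matrix.zero_apply]
  split_ifs with hs
  · rfl
  · rw [add_decouple_apply]
    have hr : ((B4.inclIdx h r).1 : Fin d → ℤ) ∈ Λ := r.1.2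
    simp [hr, hs]

/-- the compression to `Λ` of the decoupled operator is `A_Λ` (*"□′_j = □_j"* inside `Λ`). [cite:
Balaban1983RegularityDecay, (5.22) p.596] -/
theorem compress_add_decouple {Λ : Finset (Fin d → ℤ)} (h : Λ ⊆ Ω) (A : Matrix (B4.Idx Ω N) (B4.Idx Ω N) ℝ) :
    B4.compress h (A + Matrix.of fun p q : B4.Idx Ω N =>
      if ((p.1 : Fin d → ℤ) ∈ Λ ↔ (q.1 : Fin d → ℤ) ∈ Λ) then (0:ℝ) else -A p q) = B4.compress h A := by
  ext r q
  simp only [B4.compress, Matrix.submatrix_apply]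
  rw [add_decouple_apply]
  have hr : ((B4.inclIdx h r).1 : Fin d → ℤ) ∈ Λ := r.1.2
  have hq : ((B4.inclIdx h q).1 : Fin d → ℤ) ∈ Λ := q.1.2
  simp [hr, hq]

/-- **`C_Λ` IS THE DECOUPLED INVERSE ON `Λ`**: `A_Λ^{−1}(x,x′) = A_dec^{−1}(x,x′)`, `x, x′ ∈ Λ` — the identification that
turns *"the representations (5.17) for both operators C_Λ, C_Ω"* into the two expansions of (5.24) on the same cubes
(`B4Sect5Proof.deltaC_eq` with vanishing off-block). [cite: Balaban1983RegularityDecay, (5.22) p.596; (5.8) p.594] -/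
theorem inv_compress_apply_eq {Λ : Finset (Fin d → ℤ)} (h : Λ ⊆ Ω) (hγ : 0 < γ₀) (hc : 0 ≤ c₀) (hδ : 0 ≤ δ₀)
    {A : Matrix (B4.Idx Ω N) (B4.Idx Ω N) ℝ} (hA : B4.Hyp56 Ω A γ₀ c₀ δ₀) (p q : B4.Idx Λ N) :
    (B4.compress h A)⁻¹ p q = (A + Matrix.of fun p q : B4.Idx Ω N =>
      if ((p.1 : Fin d → ℤ) ∈ Λ ↔ (q.1 : Fin d → ℤ) ∈ Λ) then (0:ℝ) else -A p q)⁻¹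
        (B4.inclIdx h p) (B4.inclIdx h q) := by
  have hAB := hyp56_add_decouple Λ hc hA
  have hU := isUnit_of_hyp56 hγ hAB
  have hUΛ := isUnit_of_hyp56 hγ (hyp56_compress h hγ.le hc hδ hAB)
  have key := deltaC_eq h hU hUΛ
  rw [offBlock_add_decouple, Matrix.mul_zero, Matrix.zero_mul, sub_eq_zero, compress_add_decouple] at key
  rw [key]
  rfl

/-- p. 596, verbatim: *"If □′_j is disjoint with the complement Λ^c of Λ in Ω, then □′_j = □_j and C′_j = C_j"* — in the
decoupled bookkeeping: `C(A_dec)_j = C(A)_j` for every `Ω`-cube `□′_j ⊆ Λ` (the (5.26)-defect `B_dec,□′_j` vanishes).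
[cite: Balaban1983RegularityDecay, (5.22) p.596] -/
theorem cOp_add_decouple_eq {Λ : Finset (Fin d → ℤ)} (M : ℕ) (A : Matrix (B4.Idx Ω N) (B4.Idx Ω N) ℝ)
    {j : Fin d → ℤ} (hj : boxSet M Ω j ⊆ Λ) :
    cOp M (A + Matrix.of fun p q : B4.Idx Ω N =>
      if ((p.1 : Fin d → ℤ) ∈ Λ ↔ (q.1 : Fin d → ℤ) ∈ Λ) then (0:ℝ) else -A p q) j = cOp M A j := by
  have e : B4.compress (boxSet_subset M Ω j) (A + Matrix.of fun p q : B4.Idx Ω N =>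
      if ((p.1 : Fin d → ℤ) ∈ Λ ↔ (q.1 : Fin d → ℤ) ∈ Λ) then (0:ℝ) else -A p q) =
      B4.compress (boxSet_subset M Ω j) A := by
    ext r q
    simp only [B4.compress, Matrix.submatrix_apply]
    rw [add_decouple_apply]
    have hr : ((B4.inclIdx (boxSet_subset M Ω j) r).1 : Fin d → ℤ) ∈ Λ := hj r.1.2
    have hq : ((B4.inclIdx (boxSet_subset M Ω j) q).1 : Fin d → ℤ) ∈ Λ := hj q.1.2
    simp [hr, hq]
  rw [cOp, cOp, e]

/-- p. 596, verbatim: *"Similarly if both □′_j, □′_{j′} are disjoint with Λ^c, then R′_{j,j′} = R_{j,j′}"* — in the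
decoupled bookkeeping: `R(A_dec)_{j,j′} = R(A)_{j,j′}` (the (5.25)-defect `R(B_dec)_{j,j′} = 0`: it only sees
`□′_jB_dec□′_{j′}`, whose entries have both ends in `Λ`). [cite: Balaban1983RegularityDecay, (5.22) p.596] -/
theorem rPair_add_decouple_eq {Λ : Finset (Fin d → ℤ)} {M : ℕ} (hM : 0 < M)
    (A : Matrix (B4.Idx Ω N) (B4.Idx Ω N) ℝ) {l l' : ↥(labels M Ω)} (hl : boxSet M Ω l.1 ⊆ Λ)
    (hl' : boxSet M Ω l'.1 ⊆ Λ) :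
    rPair (A + Matrix.of fun p q : B4.Idx Ω N =>
        if ((p.1 : Fin d → ℤ) ∈ Λ ↔ (q.1 : Fin d → ℤ) ∈ Λ) then (0:ℝ) else -A p q) (pFam N M Ω) (hFam N M Ω) l l' =
      rPair A (pFam N M Ω) (hFam N M Ω) l l' := by
  rw [rPair_add, add_eq_left, rPair_mask hM]
  have e : pFam N M Ω l * (Matrix.of fun p q : B4.Idx Ω N =>
      if ((p.1 : Fin d → ℤ) ∈ Λ ↔ (q.1 : Fin d → ℤ) ∈ Λ) then (0:ℝ) else -A p q) * pFam N M Ω l' = 0 := by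
    ext k k'
    rw [pFam_mul_mul_pFam_apply, Matrix.zero_apply, Matrix.of_apply]
    by_cases hk : InBox M l.1 (k.1 : Fin d → ℤ)
    · by_cases hk' : InBox M l'.1 (k'.1 : Fin d → ℤ)
      · have hkΛ : (k.1 : Fin d → ℤ) ∈ Λ := hl (mem_boxSet.mpr ⟨k.1.2, hk⟩)
        have hk'Λ : (k'.1 : Fin d → ℤ) ∈ Λ := hl' (mem_boxSet.mpr ⟨k'.1.2, hk'⟩)
        simp [hkΛ, hk'Λ]
      · simp [hk']
    · simp [hk]
  rw [e]
  unfold rPair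
  split_ifs <;> simp

/-- **(5.8) BY THE WALK ROUTE — (5.22)–(5.23)** p. 596 [PDF 26]: *"Estimating (5.22) in the same way as in (5.18) and
(5.21), we get |δC_Λ(x,x′)| ≤ c′₁e^{−⅓δ₂M^{−1}(dist(x,Λ^c) + dist(x′,Λ^c) + |x−x′|)}. (5.23)"* — typed: constants
`c₁, δ₁ > 0` depending on `d, N, γ₀, c₀, δ₀` only such that for every finite `Ω ⊂ ℤ^d`, every `A` with (5.6) on
`L²(Ω; ℝ^N)`, every `Λ ⊆ Ω`: `|C_Λ(x,x′) − C_Ω(x,x′)| ≤ c₁e^{−δ₁(|x−x′| + dist(x,Λ^c) + dist(x′,Λ^c))}`, `x, x′ ∈ Λ`,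
`Λ^c = Ω ∖ Λ` (second clause of `B4.Concl57_58`): the difference of the expansions for `A` and `A_dec` summed by
`B4Sect5WalkPerturb.concl510_walk` with `D = dist(·,Λ^c)`. [cite: Balaban1983RegularityDecay, (5.8) p.594;
(5.22)–(5.23) p.596] -/
theorem concl58_compress_walk (d N : ℕ) (hγ : 0 < γ₀) (hc : 0 ≤ c₀) (hδ : 0 < δ₀) :
    ∃ c₁ δ₁ : ℝ, 0 < c₁ ∧ 0 < δ₁ ∧
      ∀ (Ω Λ : Finset (Fin d → ℤ)) (h : Λ ⊆ Ω) (A : Matrix (B4.Idx Ω N) (B4.Idx Ω N) ℝ),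
        B4.Hyp56 Ω A γ₀ c₀ δ₀ → ∀ p q : B4.Idx Λ N,
          |(B4.compress h A)⁻¹ p q - A⁻¹ (B4.inclIdx h p) (B4.inclIdx h q)| ≤
            c₁ * Real.exp (-(δ₁ * (dist (p.1 : Fin d → ℤ) (q.1 : Fin d → ℤ)
              + Metric.infDist (p.1 : Fin d → ℤ) (((Ω \ Λ : Finset (Fin d → ℤ))) : Set (Fin d → ℤ))
              + Metric.infDist (q.1 : Fin d → ℤ) (((Ω \ Λ : Finset (Fin d → ℤ))) : Set (Fin d → ℤ))))) := by
  have hδ2 : 0 < δ₀ / 2 := half_pos hδ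
  have hK := latticeConst_nonneg d hδ2.le
  obtain ⟨M, hM0, hM⟩ := concl510_walk d N (γ₀ := γ₀) (c₀ := c₀) hγ hc hδ2
  refine ⟨2 ^ (d + 1) * (1 + γ₀⁻¹ * (c₀ * (N * latticeConst d (δ₀ / 2)))) * γ₀⁻¹ * Real.exp (δ₀ / 2 / 4),
    δ₀ / 2 / (48 * M), by positivity, by positivity, ?_⟩
  intro Ω Λ h A hA p q
  have hA2 : B4.Hyp56 Ω A γ₀ c₀ (δ₀ / 2) := hyp56_of_delta_le hc (by linarith) hA
  have hAB2 := hyp56_add_decouple Λ hc hA2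
  have hB := decouple_bound Λ hc hδ.le hA.2.2
  have key := hM Ω A _ (fun y => Metric.infDist y (((Ω \ Λ : Finset (Fin d → ℤ))) : Set (Fin d → ℤ))) hA2 hAB2
    (fun y => Metric.infDist_nonneg) (fun y z => Metric.infDist_le_infDist_add_dist) hB
    (B4.inclIdx h p) (B4.inclIdx h q)
  rw [← inv_compress_apply_eq h hγ hc hδ2.le hA2 p q, abs_sub_comm] at key
  exact key

end Decouple

/-! ## (5.7)–(5.8) together: `B4.Concl57_58` by the printed walk route -/

section Sect5

open Literature.MathematicalPhysics.QuantumFieldTheory.Balaban1983to89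
open B4Sect5Proof B4Sect5WalkDecay B4Sect5WalkPerturb

/-- **(5.7)–(5.8) OF THE SECT. 5 THEOREM BY THE GENERALIZED RANDOM WALK** (pp. 594–596): for `(γ₀, c₀, δ₀)` there are
`c₁, δ₁ > 0` (functions of `d, N, γ₀, c₀, δ₀` — p. 597) such that for every finite `Ω ⊂ ℤ^d`, every `A` with (5.6) on
`L²(Ω; ℝ^N)` and every `Λ ⊆ Ω` the tree's `B4.Concl57_58 Ω Λ h A c₁ δ₁` holds — (5.18)–(5.21) ⇒ (5.7)
(`concl57_compress_walk`) and (5.22)–(5.23) ⇒ (5.8) (`concl58_compress_walk`) with common constants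
(`B4Sect5Proof.weaken`); together with `B4Sect5WalkPerturb.concl510_compress_walk` ((5.10)) these are the conjuncts
of `B4.Sect5ThmUniform`. [cite: Balaban1983RegularityDecay, Sect. 5 Theorem (5.7)–(5.8) p.594; pp.595–596] -/
theorem concl57_58_compress_walk (d N : ℕ) {γ₀ c₀ δ₀ : ℝ} (hγ : 0 < γ₀) (hc : 0 ≤ c₀) (hδ : 0 < δ₀) :
    ∃ c₁ δ₁ : ℝ, 0 < c₁ ∧ 0 < δ₁ ∧
      ∀ (Ω Λ : Finset (Fin d → ℤ)) (h : Λ ⊆ Ω) (A : Matrix (B4.Idx Ω N) (B4.Idx Ω N) ℝ),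
        B4.Hyp56 Ω A γ₀ c₀ δ₀ → B4.Concl57_58 Ω Λ h A c₁ δ₁ := by
  obtain ⟨c₇, δ₇, hc₇, hδ₇, h₇⟩ := concl57_compress_walk d N (γ₀ := γ₀) (c₀ := c₀) (δ₀ := δ₀) hγ hc hδ
  obtain ⟨c₈, δ₈, hc₈, hδ₈, h₈⟩ := concl58_compress_walk d N (γ₀ := γ₀) (c₀ := c₀) (δ₀ := δ₀) hγ hc hδ
  refine ⟨max c₇ c₈, min δ₇ δ₈, hc₇.trans_le (le_max_left _ _), lt_min hδ₇ hδ₈,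
    fun Ω Λ h A hA => ⟨fun p q => ?_, fun p q => ?_⟩⟩
  · exact (h₇ Ω Λ h A hA p q).trans (weaken hc₇.le (le_max_left _ _) (min_le_left _ _) dist_nonneg)
  · refine (h₈ Ω Λ h A hA p q).trans (weaken hc₈.le (le_max_right _ _) (min_le_right _ _) ?_)
    have := Metric.infDist_nonneg (x := (p.1 : Fin d → ℤ))
      (s := (((Ω \ Λ : Finset (Fin d → ℤ))) : Set (Fin d → ℤ)))
    have := Metric.infDist_nonneg (x := (q.1 : Fin d → ℤ))
      (s := (((Ω \ Λ : Finset (Fin d → ℤ))) : Set (Fin d → ℤ)))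
    have : 0 ≤ dist (p.1 : Fin d → ℤ) (q.1 : Fin d → ℤ) := dist_nonneg
    linarith

end Sect5

end Literature.MathematicalPhysics.QuantumFieldTheory.Balaban1983to89.B4Sect5WalkDelta
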